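import Literature.InformationTheory.Entanglement.MUBEntanglementDetection
import Mathlib.Analysis.Convex.Jensen
import Mathlib.Analysis.Convex.SpecificFunctions.Basic
import Mathlib.Analysis.SpecialFunctions.Log.NegMulLog
import Mathlib.Analysis.SpecialFunctions.Log.Base
import HarnessLib

/-!
# Entropic uncertainty relations for `M` mutually unbiased bases from the index of coincidence
# (Wu–Yu–Mølmer 2009, Proposition 3)

Hodge foundations lane (`lit-hodgefound`, prover p24 gen 78; quantum-information series).  THEOREMS ONLY: no
definition, no named fact, net debt 0.  Companion of `Entanglement/MUBEntanglementDetection.lean`, which proves Theorem 1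
of the same paper (`MUBDetection.WuYuMolmer_sum_sq_le`); the MUB hypotheses are again the three UNBUNDLED fields of the
tree's `IsMUBFamily` (orthonormality, `|⟨b_{ia}|b_{i'a'}⟩|² = 1/d` for `i ≠ i'`, `|κ| = |V|`).  Shannon entropies are
written with Mathlib's `Real.negMulLog` (`−x log x`, `0 log 0 = 0`): `H(p) = Σ_a negMulLog (p a)` in nats, and
`H(p)/log 2` in bits as printed.

## Source, VERBATIM — S. Wu, S. Yu, K. Mølmer, Phys. Rev. A 79, 022104 (2009) [WuYuMolmer2009] § IV
(held `paper:arxiv-0811.2298` p0006)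

«**Proposition 3.** For `M` MUBs of a qudit prepared in the state `ρ`, we have the following simple state-dependent
entropic uncertainty inequality: `Σ_{m=1}^M H{p_{i_m}; i} ≥ M log₂ (M/C)` (13) with `C = Tr(ρ²) + (M−1)/d`. Using that
`Tr(ρ²) ≤ 1`, we obtain from (13) the following state-independent entropic uncertainty inequality:
`Σ_{m=1}^M H{p_{i_m}; i} ≥ M log₂ (Md/(d+M−1))`. (15)
Proof. … (13) also follows directly from (11) [Theorem 1] by the convexity of the function `−log₂ x`.»
(§ III, p0005: «`p_{i_m} = ⟨i_m|ρ|i_m⟩` … the Shannon entropy `H{p_i; i}`»; § II: `H = −Σ_i p_i log₂ p_i`.)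

## Proof route (the printed one-line route «by the convexity of −log₂ x»)

Jensen for the concave `log` twice: `H(p) = Σ_i p_i(−log p_i) ≥ −log Σ_i p_i²` (the Shannon entropy dominates the
collision entropy), then `Σ_m −log C_m ≥ −M log((1/M) Σ_m C_m) ≥ M log(M/C)` with `C_m = Σ_i p_{i_m}²` and
`Σ_m C_m ≤ C` (Theorem 1).

## What is formalized (all PROVED)

* § 1 `neg_log_sum_sq_le_sum_negMulLog` (`−log Σ p² ≤ H(p)`), `sum_log_le_card_mul_log_avg` (Jensen for `log` with
  equal weights).
* § 2 **Proposition 3, (13)**: `WuYuMolmer_prop3` (nats: `Σ_m H_m ≥ M log(M/C)`) and `WuYuMolmer_prop3_bits` (as printed,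
  `log₂`); **(15)**: `WuYuMolmer_entropic_uncertainty` (nats) and `WuYuMolmer_entropic_uncertainty_bits`
  (`Σ_m H_m ≥ M log₂ (Md/(d+M−1))`) for density matrices.

NOT formalized: Theorem 2 / Proposition 4 (the Harremoës–Topsøe refinement), the comparison with the Maassen–Uffink and
Sánchez-Ruiz bounds.  Tree search (FAIL-DUP, 2026-09-01): `rg -il "Maassen|entropic uncertainty" Literature` → the
quantum-memory relation files under `Computability/QuantumComplexity/EntropyUncertaintyCeiling*.lean` (Berta et al.,
conditional von Neumann entropies; no MUB / index-of-coincidence statement) and prose; `rg -n "negMulLog" Literature/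
InformationTheory/Entanglement` → ∅.
-/

noncomputable section

open Matrix Finset Real
open scoped ComplexOrder

namespace Literature.InformationTheory.Entropy.MUBUncertainty

open Literature.InformationTheory.Entanglement.MUBDetection (WuYuMolmer_sum_sq_le sum_expect_eq_trace)
open Literature.LinearAlgebra.Matrix (re_trace_mul_self_le_sq_of_posSemidef)

variable {V : Type*} [Fintype V] [DecidableEq V]
variable {ι κ : Type*} [Fintype ι] [Fintype κ] [DecidableEq κ]

/-! ## § 1 Two instances of Jensen's inequality for `log` -/

omit [DecidableEq κ] in
/-- **The Shannon entropy dominates the collision entropy**: for a probability vector `p`,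
`−log Σ_a p_a² ≤ H(p) = Σ_a (−p_a log p_a)` («by the convexity of the function `−log x`»).
[cite: WuYuMolmer2009, §IV Proposition 3 proof (last sentence)] -/
theorem neg_log_sum_sq_le_sum_negMulLog {p : κ → ℝ} (hp : ∀ a, 0 ≤ p a) (hp1 : ∑ a, p a = 1) :
    -Real.log (∑ a, p a ^ 2) ≤ ∑ a, negMulLog (p a) := by
  classical
  set S : Finset κ := Finset.univ.filter (fun a => 0 < p a) with hS
  have hmemS : ∀ a ∈ S, 0 < p a := fun a ha => (Finset.mem_filter.mp ha).2
  have hout : ∀ a ∈ (Finset.univ : Finset κ), a ∉ S → p a = 0 := fun a _ ha =>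
    le_antisymm (not_lt.mp fun h => ha (Finset.mem_filter.mpr ⟨mem_univ a, h⟩)) (hp a)
  have h1S : ∑ a ∈ S, p a = 1 := by
    rw [Finset.sum_subset (Finset.subset_univ S) hout]; exact hp1
  have h2S : ∑ a ∈ S, p a • p a = ∑ a, p a ^ 2 := by
    rw [Finset.sum_subset (Finset.subset_univ S) (fun a hu ha => by rw [hout a hu ha, smul_zero])]
    exact sum_congr rfl fun a _ => by rw [smul_eq_mul, sq]
  have h3S : ∑ a ∈ S, p a • Real.log (p a) = -∑ a, negMulLog (p a) := by
    rw [Finset.sum_subset (Finset.subset_univ S) (fun a hu ha => by rw [hout a hu ha, zero_smul]),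
      ← Finset.sum_neg_distrib]
    exact sum_congr rfl fun a _ => by simp only [negMulLog, smul_eq_mul, neg_mul, neg_neg]
  have hJ := (strictConcaveOn_log_Ioi.concaveOn).le_map_sum (t := S) (w := p) (p := p)
    (fun a _ => hp a) h1S (fun a ha => hmemS a ha)
  rw [h2S, h3S] at hJ
  linarith

/-- **Jensen for `log` with equal weights**: for positive `C_i`, `Σ_i log C_i ≤ M log((Σ_i C_i)/M)`, `M = |ι| > 0`.
[cite: WuYuMolmer2009, §IV Proposition 3 proof («from the convexity of the function `x log₂ x`» / «of `−log₂ x`»)] -/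
theorem sum_log_le_card_mul_log_avg [Nonempty ι] {C : ι → ℝ} (hC : ∀ i, 0 < C i) :
    ∑ i, Real.log (C i) ≤ (Fintype.card ι : ℝ) * Real.log ((∑ i, C i) / Fintype.card ι) := by
  have hM : (0 : ℝ) < Fintype.card ι := Nat.cast_pos.mpr Fintype.card_pos
  have hJ := (strictConcaveOn_log_Ioi.concaveOn).le_map_sum (t := Finset.univ) (w := fun _ : ι => (Fintype.card ι : ℝ)⁻¹)
    (p := C) (fun _ _ => inv_nonneg.mpr hM.le)
    (by rw [Finset.sum_const, Finset.card_univ, nsmul_eq_mul, mul_inv_cancel₀ hM.ne']) (fun i _ => hC i)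
  simp only [smul_eq_mul, ← Finset.mul_sum] at hJ
  rw [← div_le_iff₀' hM] 
  calc (∑ i, Real.log (C i)) / Fintype.card ι = (Fintype.card ι : ℝ)⁻¹ * ∑ i, Real.log (C i) := by
        rw [div_eq_inv_mul]
    _ ≤ Real.log ((Fintype.card ι : ℝ)⁻¹ * ∑ i, C i) := hJ
    _ = Real.log ((∑ i, C i) / Fintype.card ι) := by rw [div_eq_inv_mul]

/-! ## § 2 Proposition 3 -/

/-- **Proposition 3, (13) (Wu–Yu–Mølmer 2009)**, natural logarithms: for a density matrix `ρ` on `ℂ^V` (`d = |V|`) and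
`M = |ι| ≥ 1` mutually unbiased bases `{b_{ia}}_a`, the outcome distributions `p_{ia} = ⟨b_{ia}|ρ|b_{ia}⟩` satisfy
`Σ_i H(p_i) ≥ M log(M/C)`, `C = Tr ρ² + (M−1)/d`, `H(p) = Σ_a (−p_a log p_a)`.
[cite: WuYuMolmer2009, §IV Proposition 3, (13)] -/
theorem WuYuMolmer_prop3 [Nonempty ι] {B : ι → κ → V → ℂ}
    (hon : ∀ i a a', star (B i a) ⬝ᵥ B i a' = if a = a' then 1 else 0)
    (hmu : ∀ i i', i ≠ i' → ∀ a a', Complex.normSq (star (B i a) ⬝ᵥ B i' a') = 1 / (Fintype.card V : ℝ))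
    (hcard : Fintype.card κ = Fintype.card V) {ρ : Matrix V V ℂ} (hρ : ρ.PosSemidef) (hρ1 : ρ.trace = 1) :
    (Fintype.card ι : ℝ) * Real.log ((Fintype.card ι : ℝ) /
        ((ρ * ρ).trace.re + ((Fintype.card ι : ℝ) - 1) / (Fintype.card V : ℝ))) ≤
      ∑ i, ∑ a, negMulLog ((star (B i a) ⬝ᵥ ρ *ᵥ B i a).re) := by
  have hM : (0 : ℝ) < Fintype.card ι := Nat.cast_pos.mpr Fintype.card_pos
  -- the outcome distributions are probability vectors
  have hp0 : ∀ i a, 0 ≤ (star (B i a) ⬝ᵥ ρ *ᵥ B i a).re := fun i a =>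
    (Complex.nonneg_iff.mp (hρ.dotProduct_mulVec_nonneg (B i a))).1
  have hp1 : ∀ i, ∑ a, (star (B i a) ⬝ᵥ ρ *ᵥ B i a).re = 1 := fun i => by
    rw [← Complex.re_sum, sum_expect_eq_trace (hon i) hcard ρ, hρ1, Complex.one_re]
  -- `C_i = Σ_a p_{ia}² > 0`
  set C : ι → ℝ := fun i => ∑ a, (star (B i a) ⬝ᵥ ρ *ᵥ B i a).re ^ 2 with hCdef
  have hCpos : ∀ i, 0 < C i := by
    intro i
    obtain ⟨a, -, ha⟩ : ∃ a ∈ (Finset.univ : Finset κ), 0 < (star (B i a) ⬝ᵥ ρ *ᵥ B i a).re := by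
      by_contra h
      push Not at h
      have : ∑ a, (star (B i a) ⬝ᵥ ρ *ᵥ B i a).re ≤ 0 := Finset.sum_nonpos fun a ha => h a ha
      linarith [hp1 i]
    exact lt_of_lt_of_le (pow_pos ha 2) (Finset.single_le_sum (f := fun a => (star (B i a) ⬝ᵥ ρ *ᵥ B i a).re ^ 2)
      (fun a _ => sq_nonneg _) (mem_univ a))
  have hCsum : 0 < ∑ i, C i := Finset.sum_pos (fun i _ => hCpos i) Finset.univ_nonempty
  -- Theorem 1: `Σ_i C_i ≤ C`
  have hT1 : ∑ i, C i ≤ (ρ * ρ).trace.re + ((Fintype.card ι : ℝ) - 1) / (Fintype.card V : ℝ) :=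
    WuYuMolmer_sum_sq_le hon hmu hcard hρ.1 hρ1
  -- Jensen twice
  have h1 : ∑ i, -Real.log (C i) ≤ ∑ i, ∑ a, negMulLog ((star (B i a) ⬝ᵥ ρ *ᵥ B i a).re) :=
    sum_le_sum fun i _ => neg_log_sum_sq_le_sum_negMulLog (hp0 i) (hp1 i)
  have h2 := sum_log_le_card_mul_log_avg hCpos
  have h3 : Real.log ((∑ i, C i) / Fintype.card ι) ≤
      Real.log (((ρ * ρ).trace.re + ((Fintype.card ι : ℝ) - 1) / (Fintype.card V : ℝ)) / Fintype.card ι) :=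
    Real.log_le_log (div_pos hCsum hM) (div_le_div_of_nonneg_right hT1 hM.le)
  have h4 : Real.log ((Fintype.card ι : ℝ) /
      ((ρ * ρ).trace.re + ((Fintype.card ι : ℝ) - 1) / (Fintype.card V : ℝ))) =
      -Real.log (((ρ * ρ).trace.re + ((Fintype.card ι : ℝ) - 1) / (Fintype.card V : ℝ)) / Fintype.card ι) := by
    rw [← Real.log_inv, inv_div]
  rw [Finset.sum_neg_distrib] at h1
  rw [h4]
  nlinarith [h1, h2, h3, hM]

/-- **Proposition 3, (13), as printed (bits)**: `Σ_m H{p_{i_m}; i} ≥ M log₂(M/C)` with `H` the Shannon entropy in bits.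
[cite: WuYuMolmer2009, §IV Proposition 3, (13)] -/
theorem WuYuMolmer_prop3_bits [Nonempty ι] {B : ι → κ → V → ℂ}
    (hon : ∀ i a a', star (B i a) ⬝ᵥ B i a' = if a = a' then 1 else 0)
    (hmu : ∀ i i', i ≠ i' → ∀ a a', Complex.normSq (star (B i a) ⬝ᵥ B i' a') = 1 / (Fintype.card V : ℝ))
    (hcard : Fintype.card κ = Fintype.card V) {ρ : Matrix V V ℂ} (hρ : ρ.PosSemidef) (hρ1 : ρ.trace = 1) :
    (Fintype.card ι : ℝ) * Real.logb 2 ((Fintype.card ι : ℝ) /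
        ((ρ * ρ).trace.re + ((Fintype.card ι : ℝ) - 1) / (Fintype.card V : ℝ))) ≤
      ∑ i, (∑ a, negMulLog ((star (B i a) ⬝ᵥ ρ *ᵥ B i a).re)) / Real.log 2 := by
  have h := WuYuMolmer_prop3 hon hmu hcard hρ hρ1
  have hlog2 : 0 < Real.log 2 := Real.log_pos one_lt_two
  rw [← Finset.sum_div, le_div_iff₀ hlog2, Real.logb, mul_assoc, div_mul_cancel₀ _ hlog2.ne']
  exact h

/-- **The state-independent relation (15)**, natural logarithms: `Σ_m H_m ≥ M log(Md/(d+M−1))` for every density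
matrix (from (13) and `Tr ρ² ≤ 1`). [cite: WuYuMolmer2009, §IV Proposition 3, (15)] -/
theorem WuYuMolmer_entropic_uncertainty [Nonempty ι] {B : ι → κ → V → ℂ}
    (hon : ∀ i a a', star (B i a) ⬝ᵥ B i a' = if a = a' then 1 else 0)
    (hmu : ∀ i i', i ≠ i' → ∀ a a', Complex.normSq (star (B i a) ⬝ᵥ B i' a') = 1 / (Fintype.card V : ℝ))
    (hcard : Fintype.card κ = Fintype.card V) {ρ : Matrix V V ℂ} (hρ : ρ.PosSemidef) (hρ1 : ρ.trace = 1) :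
    (Fintype.card ι : ℝ) * Real.log ((Fintype.card ι : ℝ) * (Fintype.card V : ℝ) /
        ((Fintype.card V : ℝ) + (Fintype.card ι : ℝ) - 1)) ≤
      ∑ i, ∑ a, negMulLog ((star (B i a) ⬝ᵥ ρ *ᵥ B i a).re) := by
  have h := WuYuMolmer_prop3 hon hmu hcard hρ hρ1
  have hM : (0 : ℝ) < Fintype.card ι := Nat.cast_pos.mpr Fintype.card_pos
  -- `d ≥ 1` (a trace-one matrix lives on a nonempty index type)
  have hVne : Nonempty V := by
    by_contra hV
    rw [not_nonempty_iff] at hV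
    have : ρ.trace = 0 := by simp [Matrix.trace]
    rw [this] at hρ1
    exact zero_ne_one hρ1
  have hd : (0 : ℝ) < Fintype.card V := Nat.cast_pos.mpr Fintype.card_pos
  -- `Tr ρ² ≤ 1`, so `C ≤ (d + M − 1)/d`
  have hpur : (ρ * ρ).trace.re ≤ 1 := by
    have hp := re_trace_mul_self_le_sq_of_posSemidef hρ
    rw [hρ1, Complex.one_re, one_pow] at hp
    exact hp
  have hCpos : 0 < (ρ * ρ).trace.re + ((Fintype.card ι : ℝ) - 1) / (Fintype.card V : ℝ) := by
    -- `Tr ρ² ≥ (Tr ρ)²/d = 1/d > 0` would do; simpler: `Tr ρ² > 0` unless `ρ = 0`. Use Theorem 1's left side instead: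
    -- `C ≥ Σ_i C_i > 0`.
    have hp1 : ∀ i, ∑ a, (star (B i a) ⬝ᵥ ρ *ᵥ B i a).re = 1 := fun i => by
      rw [← Complex.re_sum, sum_expect_eq_trace (hon i) hcard ρ, hρ1, Complex.one_re]
    obtain ⟨i⟩ := ‹Nonempty ι›
    obtain ⟨a, -, ha⟩ : ∃ a ∈ (Finset.univ : Finset κ), 0 < (star (B i a) ⬝ᵥ ρ *ᵥ B i a).re := by
      by_contra h'
      push Not at h'
      have : ∑ a, (star (B i a) ⬝ᵥ ρ *ᵥ B i a).re ≤ 0 := Finset.sum_nonpos fun a ha => h' a ha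
      linarith [hp1 i]
    have hT1 := WuYuMolmer_sum_sq_le hon hmu hcard hρ.1 hρ1
    have hle : (star (B i a) ⬝ᵥ ρ *ᵥ B i a).re ^ 2 ≤ ∑ i, ∑ a, (star (B i a) ⬝ᵥ ρ *ᵥ B i a).re ^ 2 :=
      (Finset.single_le_sum (f := fun a => (star (B i a) ⬝ᵥ ρ *ᵥ B i a).re ^ 2) (fun a _ => sq_nonneg _)
        (mem_univ a)).trans
        (Finset.single_le_sum (f := fun i => ∑ a, (star (B i a) ⬝ᵥ ρ *ᵥ B i a).re ^ 2)
          (fun i _ => sum_nonneg fun a _ => sq_nonneg _) (mem_univ i))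
    nlinarith [pow_pos ha 2]
  have hmono : Real.log ((Fintype.card ι : ℝ) * (Fintype.card V : ℝ) / ((Fintype.card V : ℝ) + (Fintype.card ι : ℝ) - 1)) ≤
      Real.log ((Fintype.card ι : ℝ) / ((ρ * ρ).trace.re + ((Fintype.card ι : ℝ) - 1) / (Fintype.card V : ℝ))) := by
    have hM1 : (1 : ℝ) ≤ Fintype.card ι := by exact_mod_cast (Fintype.card_pos (α := ι))
    have hden : 0 < (Fintype.card V : ℝ) + (Fintype.card ι : ℝ) - 1 := by linarith
    refine Real.log_le_log (div_pos (mul_pos hM hd) hden) ?_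
    rw [div_le_div_iff₀ hden hCpos]
    -- `M d C ≤ M (d + M − 1)` since `d C = d Tr ρ² + M − 1 ≤ d + M − 1`
    have : (Fintype.card V : ℝ) * ((ρ * ρ).trace.re + ((Fintype.card ι : ℝ) - 1) / (Fintype.card V : ℝ)) ≤
        (Fintype.card V : ℝ) + (Fintype.card ι : ℝ) - 1 := by
      rw [mul_add, mul_div_cancel₀ _ hd.ne']
      nlinarith
    nlinarith
  nlinarith [hmono, hM]

/-- **The state-independent relation (15), as printed (bits)**: `Σ_{m=1}^M H{p_{i_m}; i} ≥ M log₂(Md/(d+M−1))`.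
[cite: WuYuMolmer2009, §IV Proposition 3, (15)] -/
theorem WuYuMolmer_entropic_uncertainty_bits [Nonempty ι] {B : ι → κ → V → ℂ}
    (hon : ∀ i a a', star (B i a) ⬝ᵥ B i a' = if a = a' then 1 else 0)
    (hmu : ∀ i i', i ≠ i' → ∀ a a', Complex.normSq (star (B i a) ⬝ᵥ B i' a') = 1 / (Fintype.card V : ℝ))
    (hcard : Fintype.card κ = Fintype.card V) {ρ : Matrix V V ℂ} (hρ : ρ.PosSemidef) (hρ1 : ρ.trace = 1) :
    (Fintype.card ι : ℝ) * Real.logb 2 ((Fintype.card ι : ℝ) * (Fintype.card V : ℝ) /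
        ((Fintype.card V : ℝ) + (Fintype.card ι : ℝ) - 1)) ≤
      ∑ i, (∑ a, negMulLog ((star (B i a) ⬝ᵥ ρ *ᵥ B i a).re)) / Real.log 2 := by
  have h := WuYuMolmer_entropic_uncertainty hon hmu hcard hρ hρ1
  have hlog2 : 0 < Real.log 2 := Real.log_pos one_lt_two
  rw [← Finset.sum_div, le_div_iff₀ hlog2, Real.logb, mul_assoc, div_mul_cancel₀ _ hlog2.ne']
  exact h

end Literature.InformationTheory.Entropy.MUBUncertainty
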